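import Literature.Analysis.FluidPDE.NormalisedPressureL2Bound
import Literature.Analysis.FluidPDE.VorticityStretching
import Literature.Analysis.FluidPDE.Vorticity
import Literature.Analysis.FluidPDE.WholeSpaceIBP
import HarnessLib

/-!
# The Biot–Savart integral of a test field through the Newtonian potential:
`K₃ * Φ = −Γ * curl Φ`, `K₃ * ∇θ = 0`, and Green's representation `Γ * Δψ = ψ`

Analysis/FluidPDE support file (all results proved, no definitions) on the decomposition path of
the named fact `Literature.Analysis.FluidPDE.biotSavart_curl_eq_self` (`Vorticity.lean`;
Majda–Bertozzi, *Vorticity and Incompressible Flow*, §2.4.1 Prop. 2.16: `v = K₃ * ω = −curl ψ`,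
`ψ` the Newtonian potential of `ω`, (2.92)–(2.94)), a brick of
`Literature.Analysis.FluidPDE.MajdaBertozzi2002_holderEulerUniqueness`
(`ElgindiAprioriBlowupProofs.lean`). For a merely continuous vorticity `ω` the weak divergence and
weak curl of `K₃ * ω` are computed by symmetry, `∫ ⟪K₃ * ω, Φ⟫ = ∫ ⟪ω, K₃ * Φ⟫`, from the
Biot–Savart integral of a *test field* `Φ`; this file computes the latter with the tree's
Newtonian kernel `Γ = newtonKernel = −(4π|·|)⁻¹` (`NewtonKernel`, `∇Γ(z) = z/(4π|z|³)`, so that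
`K(z) h = h × ∇Γ(z)`):

* `fderiv_newtonKernel_zero`, `norm_fderiv_newtonKernel_le`: `‖DΓ(z)‖ ≤ (4π|z|²)⁻¹` for all `z`;
  `fderiv_newtonReg_eq` and `exists_norm_fderiv_newtonReg_sub_fderiv_newtonKernel_le`: the
  gradient of the tree's regularised kernel `Φ_ε = newtonReg ε` (`NormalisedPressureL2Bound`)
  agrees with `DΓ` off the ball `|z| < 2ε` and differs by `O(1_{|z|<2ε}|z|⁻²)` on it;
* `integral_newtonKernel_smul_fderiv_eq` — **the distributional gradient of `Γ` is its
  pointwise gradient**: `∫ Γ(y − x) • ∂ₐΦ(x) dx = ∫ ∂ₐΓ(y − x) • Φ(x) dx` for `Φ ∈ C¹_c(ℝ³; F)`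
  (integration by parts against `Φ_ε`, `integral_newtonReg_smul_fderiv_eq`, and `ε → 0⁺` on both
  sides, `tendsto_integral_newtonReg_smul`, `tendsto_integral_fderiv_newtonReg_smul`);
* `biotSavart_eq_neg_integral_newtonKernel_smul_curl` — **`(K₃ * Φ)(y) = −∫ Γ(y − x) curl Φ(x) dx`**
  for `Φ ∈ C¹_c` (pointwise `K(z) h = −curlCLM (DΓ(z) ⊗ h)`,
  `biotSavartKernel_eq_neg_curlCLM_smulRight`; `curlCLM` commutes with the Bochner integral; the
  previous identity vector by vector);
* `biotSavart_gradient_eq_zero` — **`K₃ * ∇θ = 0`** for `θ ∈ C²_c` (`curl ∇ = 0`);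
* `integral_newtonKernel_mul_laplacian` — **Green's representation** `∫ Γ(y − x) Δψ(x) dx = ψ(y)`
  for `ψ ∈ C²_c` (Gilbarg–Trudinger (2.17)), from the tree's localised
  `NewtonPotential.integral_newtonNear_mul_laplacian` with `y`-dependent radii.

## Mathlib / tree search

Tree: `newtonKernel`, `fderiv_newtonKernel`, `norm_fderiv_newtonKernel`, `newtonFar`,
`exists_bound_newtonFar_derivs`, `newtonNear_eq_newtonKernel`, `newtonFarLaplacian_eq_zero_of_lt`
(`NewtonKernel`); `integral_newtonNear_mul_laplacian` (`NewtonPotential`); `newtonReg`,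
`abs_newtonReg_sub_newtonKernel_le`, `integrable_newtonKernel_mul`, `nearProfile₂`
(`NormalisedPressureL2Bound`, `TaoEnergyLocalisationPressure`); `fderiv_const_smul_comp_smul`,
`fderiv_comp_const_sub`, `laplacian_comp_const_sub` (`HarmonicProbe`);
`integral_fderiv_apply_eq_zero`, `laplacian_eq_zero_of_notMem_tsupport` (`WholeSpaceIBP`);
`curlCLM`, `curlCLM_apply`, `curl_eq_curlCLM` (`TaoEnstrophyLocalisation`, `VorticityStretching`);
`curl_gradient_eq_zero_holds`, `cross`, `crossCLM` (`VectorCalculus`); `biotSavart`,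
`biotSavartKernel` (`Vorticity`). Mathlib: `ContinuousLinearMap.integral_comp_comm`,
`ContinuousLinearMap.integral_apply`, `measurable_fderiv`, `tendsto_nhds_unique`,
`cross_anticomm`, `EuclideanSpace.inner_single_right`.

## References

* A. J. Majda, A. L. Bertozzi, *Vorticity and Incompressible Flow* (CUP 2002), §2.4.1
  Prop. 2.16 with (2.92)–(2.95) (p. 63–64 of the held text). [MajdaBertozziCUP2002]
* D. Gilbarg, N. S. Trudinger, *Elliptic partial differential equations of second order*
  (Springer, 2001 reprint), (2.17), Lemma 4.1. [GilbargTrudinger2001]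
-/

noncomputable section

open MeasureTheory Set Filter Topology Function Metric InnerProductSpace
open scoped ENNReal NNReal RealInnerProductSpace Laplacian

namespace Literature.Analysis.FluidPDE

/-! ### The gradient of the Newtonian kernel and of its regularisation -/

/-- The Newtonian kernel is not continuous at the origin (it is `−(4π‖z‖)⁻¹`), hence not
differentiable there, so `fderiv ℝ newtonKernel 0 = 0` (Mathlib's junk value). [folklore] -/
theorem fderiv_newtonKernel_zero : fderiv ℝ newtonKernel (0 : (EuclideanSpace ℝ (Fin 3))) = 0 := by
  refine fderiv_zero_of_not_differentiableAt fun hd => ?_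
  have hc : ContinuousAt newtonKernel (0 : (EuclideanSpace ℝ (Fin 3))) := hd.continuousAt
  -- along `zₙ = (n+1)⁻¹ e₀` the values `−(n+1)/(4π)` are unbounded
  have h0 : newtonKernel (0 : (EuclideanSpace ℝ (Fin 3))) = 0 := by
    rw [newtonKernel_eq, norm_zero, mul_zero, inv_zero, neg_zero]
  rw [ContinuousAt, h0, Metric.tendsto_nhds] at hc
  obtain ⟨δ, hδ, hball⟩ := Metric.eventually_nhds_iff.1 (hc 1 one_pos)
  -- pick a point of norm `r = min (δ/2) (8π)⁻¹`
  set r : ℝ := min (δ / 2) (8 * Real.pi)⁻¹ with hr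
  have hr0 : 0 < r := by positivity
  set z : (EuclideanSpace ℝ (Fin 3)) := r • EuclideanSpace.single (0 : Fin 3) (1 : ℝ) with hz
  have hzn : ‖z‖ = r := by
    rw [hz, norm_smul, EuclideanSpace.single, PiLp.norm_single, norm_one, mul_one,
      Real.norm_of_nonneg hr0.le]
  have hzd : dist z 0 < δ := by
    rw [dist_zero_right, hzn, hr]
    exact (min_le_left _ _).trans_lt (by linarith)
  have h1 := hball hzd
  rw [Real.dist_eq, sub_zero, newtonKernel_eq, hzn, abs_neg, abs_inv,
    abs_of_pos (by positivity : 0 < 4 * Real.pi * r)] at h1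
  -- but `(4πr)⁻¹ ≥ 2`
  have h2 : 4 * Real.pi * r ≤ 2⁻¹ := by
    have : r ≤ (8 * Real.pi)⁻¹ := min_le_right _ _
    calc 4 * Real.pi * r ≤ 4 * Real.pi * (8 * Real.pi)⁻¹ := by gcongr
      _ = 2⁻¹ := by field_simp; ring
  have h3 : (2 : ℝ) ≤ (4 * Real.pi * r)⁻¹ := by
    rw [show (2 : ℝ) = (2⁻¹)⁻¹ by norm_num]
    exact inv_anti₀ (by positivity) h2
  linarith

/-- `‖DΓ(z)‖ ≤ (4π‖z‖²)⁻¹` for all `z` (equality off the origin, `norm_fderiv_newtonKernel`; both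
sides vanish at the origin). [folklore] -/
theorem norm_fderiv_newtonKernel_le (z : (EuclideanSpace ℝ (Fin 3))) : ‖fderiv ℝ newtonKernel z‖ ≤ (4 * Real.pi * ‖z‖ ^ 2)⁻¹ := by
  rcases eq_or_ne z 0 with rfl | hz
  · rw [fderiv_newtonKernel_zero, norm_zero, norm_zero]
    simp
  · exact (norm_fderiv_newtonKernel hz).le

/-- **Scaling of the gradient of the regularised kernel**: `DΦ_ε(z) = ε⁻² DΓ∞(ε⁻¹z)` with
`Γ∞ = newtonFar (1/2) 1`, hence `‖DΦ_ε(z)‖ ≤ ε⁻² M₁` for a bound `M₁` of `‖DΓ∞‖`. [folklore] -/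
theorem fderiv_newtonReg_eq {ε : ℝ} (hε : 0 < ε) (z : (EuclideanSpace ℝ (Fin 3))) :
    fderiv ℝ (newtonReg ε) z = (ε⁻¹ * ε⁻¹) • fderiv ℝ (newtonFar (1 / 2) 1) (ε⁻¹ • z) := by
  have e : newtonReg ε = fun w => ε⁻¹ • newtonFar (1 / 2) 1 (ε⁻¹ • w) := by
    funext w; rw [newtonReg, smul_eq_mul]
  rw [e, fderiv_const_smul_comp_smul _ _ (inv_ne_zero hε.ne')]

/-- **The gradients of `Φ_ε` and `Γ` differ only on the ball `‖z‖ < 2ε`, by `O(‖z‖⁻²)`**: there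
is a constant `C` with `‖DΦ_ε(z) − DΓ(z)‖ ≤ C · 1_{‖z‖<2ε} ‖z‖⁻²` for all `ε > 0` and all `z`
(`DΦ_ε = DΓ` off the closed ball of radius `ε`; inside, `‖DΦ_ε‖ ≤ ε⁻²M₁ ≤ 4M₁‖z‖⁻²` by the
scaling law and `‖DΓ‖ = (4π‖z‖²)⁻¹`). [folklore] -/
theorem exists_norm_fderiv_newtonReg_sub_fderiv_newtonKernel_le :
    ∃ C : ℝ, 0 ≤ C ∧ ∀ ε : ℝ, 0 < ε → ∀ z : (EuclideanSpace ℝ (Fin 3)),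
      ‖fderiv ℝ (newtonReg ε) z - fderiv ℝ newtonKernel z‖ ≤ C * nearProfile₂ (2 * ε) ‖z‖ := by
  obtain ⟨-, ⟨M₁, hM₁⟩, -⟩ := exists_bound_newtonFar_derivs (r₀ := 1 / 2) (r₁ := 1)
    (by norm_num) (by norm_num)
  have hM0 : 0 ≤ M₁ := (norm_nonneg _).trans (hM₁ 0)
  refine ⟨4 * M₁ + (4 * Real.pi)⁻¹, by positivity, fun ε hε z => ?_⟩
  by_cases h2 : 2 * ε ≤ ‖z‖
  · -- off the ball: the gradients agree
    have hz : ε < ‖z‖ := by linarith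
    rw [(newtonReg_eventuallyEq_newtonKernel hε hz).fderiv_eq, sub_self, norm_zero]
    exact mul_nonneg (by positivity) (nearProfile₂_nonneg _ _)
  rw [not_le] at h2
  rcases eq_or_ne z 0 with rfl | hz0
  · -- at the origin both gradients vanish
    have h1 : fderiv ℝ (newtonReg ε) 0 = 0 := by
      rw [fderiv_newtonReg_eq hε, smul_zero,
        (newtonFar_eventuallyEq_zero (r₀ := 1 / 2) (r₁ := 1) (by norm_num) (by norm_num)
          (by rw [norm_zero]; norm_num)).fderiv_eq]
      simp
    rw [h1, fderiv_newtonKernel_zero, sub_self, norm_zero]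
    exact mul_nonneg (by positivity) (nearProfile₂_nonneg _ _)
  -- inside the punctured ball
  have hzn : 0 < ‖z‖ := norm_pos_iff.2 hz0
  have hreg : ‖fderiv ℝ (newtonReg ε) z‖ ≤ 4 * M₁ * (‖z‖ ^ 2)⁻¹ := by
    rw [fderiv_newtonReg_eq hε, norm_smul, Real.norm_of_nonneg (by positivity)]
    have h3 : ε⁻¹ * ε⁻¹ ≤ 4 * (‖z‖ ^ 2)⁻¹ := by
      rw [← mul_inv, show (4 : ℝ) * (‖z‖ ^ 2)⁻¹ = ((‖z‖ / 2) * (‖z‖ / 2))⁻¹ by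
        field_simp; ring]
      exact inv_anti₀ (by positivity) (by nlinarith)
    calc ε⁻¹ * ε⁻¹ * ‖fderiv ℝ (newtonFar (1 / 2) 1) (ε⁻¹ • z)‖ ≤ 4 * (‖z‖ ^ 2)⁻¹ * M₁ :=
          mul_le_mul h3 (hM₁ _) (norm_nonneg _) (by positivity)
      _ = 4 * M₁ * (‖z‖ ^ 2)⁻¹ := by ring
  have hker : ‖fderiv ℝ newtonKernel z‖ ≤ (4 * Real.pi)⁻¹ * (‖z‖ ^ 2)⁻¹ := by
    rw [norm_fderiv_newtonKernel hz0, mul_inv]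
  unfold nearProfile₂
  rw [if_pos h2]
  calc ‖fderiv ℝ (newtonReg ε) z - fderiv ℝ newtonKernel z‖
      ≤ ‖fderiv ℝ (newtonReg ε) z‖ + ‖fderiv ℝ newtonKernel z‖ := norm_sub_le _ _
    _ ≤ 4 * M₁ * (‖z‖ ^ 2)⁻¹ + (4 * Real.pi)⁻¹ * (‖z‖ ^ 2)⁻¹ := add_le_add hreg hker
    _ = (4 * M₁ + (4 * Real.pi)⁻¹) * (‖z‖ ^ 2)⁻¹ := by ring


/-! ### The distributional gradient of the Newtonian kernel is its pointwise gradient -/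

section WeakGradient

variable {F : Type*} [NormedAddCommGroup F] [NormedSpace ℝ F]

/-- Integrability of `x ↦ Γ(y − x) • g(x)` for `g ∈ C_c` (the tree's `integrable_newtonKernel_mul`,
vector-valued). [folklore] -/
theorem integrable_newtonKernel_smul {g : (EuclideanSpace ℝ (Fin 3)) → F} (hg : Continuous g) (hgc : HasCompactSupport g)
    (y : (EuclideanSpace ℝ (Fin 3))) : Integrable fun x => newtonKernel (y - x) • g x := by
  have h := integrable_newtonKernel_mul hg.norm hgc.norm y
  refine h.norm.mono' ?_ (Eventually.of_forall fun x => le_of_eq ?_)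
  · exact (measurable_newtonKernel.comp (measurable_const.sub measurable_id)).aestronglyMeasurable.smul
      hg.aestronglyMeasurable
  · rw [norm_smul, norm_mul, norm_norm]

/-- Integrability of `x ↦ DΓ(y − x)(a) • g(x)` for `g ∈ C_c` (`‖DΓ(w)‖ ≤ (4π‖w‖²)⁻¹` is locally
integrable in `ℝ³`). [folklore] -/
theorem integrable_fderiv_newtonKernel_smul {g : (EuclideanSpace ℝ (Fin 3)) → F} (hg : Continuous g)
    (hgc : HasCompactSupport g) (y a : (EuclideanSpace ℝ (Fin 3))) :
    Integrable fun x => (fderiv ℝ newtonKernel (y - x) a) • g x := by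
  obtain ⟨R, hR⟩ : ∃ R : ℝ, tsupport g ⊆ closedBall (0 : (EuclideanSpace ℝ (Fin 3))) R :=
    (hgc.isCompact.isBounded).subset_closedBall 0
  obtain ⟨G, hG⟩ := hg.bounded_above_of_compact_support hgc
  have hG0 : 0 ≤ G := (norm_nonneg _).trans (hG 0)
  set ρ : ℝ := ‖y‖ + |R| + 1 with hρ
  have hρ0 : 0 < ρ := by positivity
  have hmaj : Integrable fun x : (EuclideanSpace ℝ (Fin 3)) => (4 * Real.pi)⁻¹ * ‖a‖ * G * nearProfile₂ ρ ‖y - x‖ :=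
    ((integrable_nearProfile₂_norm hρ0).comp_sub_left y).const_mul _
  refine hmaj.mono' ?_ (Eventually.of_forall fun x => ?_)
  · have h1 : Measurable fun x : (EuclideanSpace ℝ (Fin 3)) => fderiv ℝ newtonKernel (y - x) a :=
      (measurable_fderiv_apply_const ℝ newtonKernel a).comp (measurable_const.sub measurable_id)
    exact h1.aestronglyMeasurable.smul hg.aestronglyMeasurable
  · by_cases hx : x ∈ tsupport g
    · have hxn : ‖x‖ ≤ R := mem_closedBall_zero_iff.1 (hR hx)
      have hyx : ‖y - x‖ < ρ := by
        calc ‖y - x‖ ≤ ‖y‖ + ‖x‖ := norm_sub_le _ _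
          _ ≤ ‖y‖ + |R| := by linarith [le_abs_self R]
          _ < ρ := by rw [hρ]; linarith
      rw [norm_smul]
      calc ‖fderiv ℝ newtonKernel (y - x) a‖ * ‖g x‖
          ≤ ((4 * Real.pi * ‖y - x‖ ^ 2)⁻¹ * ‖a‖) * G :=
            mul_le_mul ((ContinuousLinearMap.le_opNorm _ _).trans
              (mul_le_mul_of_nonneg_right (norm_fderiv_newtonKernel_le _) (norm_nonneg _)))
              (hG x) (norm_nonneg _) (by positivity)
        _ = (4 * Real.pi)⁻¹ * ‖a‖ * G * nearProfile₂ ρ ‖y - x‖ := by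
            unfold nearProfile₂
            rw [if_pos hyx, mul_inv]
            ring
    · rw [image_eq_zero_of_notMem_tsupport hx, smul_zero, norm_zero]
      exact mul_nonneg (by positivity) (nearProfile₂_nonneg _ _)

/-- **Integration by parts against the regularised kernel** (no boundary terms):
`∫ Φ_ε(y − x) • ∂ₐΦ(x) dx = ∫ ∂ₐΦ_ε(y − x) • Φ(x) dx` for `Φ ∈ C¹_c` (the sign of the chain rule for
`x ↦ y − x` cancels the sign of the integration by parts; scalar version:
`integral_fderiv_mul_comp_sub`, `HarmonicProbe`). [folklore] -/
theorem integral_newtonReg_smul_fderiv_eq {Φ : (EuclideanSpace ℝ (Fin 3)) → F} (hΦ : ContDiff ℝ 1 Φ)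
    (hc : HasCompactSupport Φ) (ε : ℝ) (y a : (EuclideanSpace ℝ (Fin 3))) :
    ∫ x, newtonReg ε (y - x) • fderiv ℝ Φ x a = ∫ x, (fderiv ℝ (newtonReg ε) (y - x) a) • Φ x := by
  have hN : ContDiff ℝ 1 fun x : (EuclideanSpace ℝ (Fin 3)) => newtonReg ε (y - x) :=
    (contDiff_newtonReg ε).comp (contDiff_const.sub contDiff_id)
  have hP : ContDiff ℝ 1 fun x => newtonReg ε (y - x) • Φ x := hN.smul hΦ
  have hPc : HasCompactSupport fun x => newtonReg ε (y - x) • Φ x := hc.smul_left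
  have h0 := FluidPDE.integral_fderiv_apply_eq_zero hP hPc a
  have hpt : ∀ x, fderiv ℝ (fun x => newtonReg ε (y - x) • Φ x) x a =
      newtonReg ε (y - x) • fderiv ℝ Φ x a - (fderiv ℝ (newtonReg ε) (y - x) a) • Φ x := by
    intro x
    rw [fderiv_fun_smul (hN.differentiable one_ne_zero x) (hΦ.differentiable one_ne_zero x),
      fderiv_comp_const_sub]
    simp only [_root_.add_apply, _root_.FunLike.coe_smul, Pi.smul_apply,
      ContinuousLinearMap.smulRight_apply, _root_.neg_apply, neg_smul]
    abel
  simp_rw [hpt] at h0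
  have i1 : Integrable fun x => newtonReg ε (y - x) • fderiv ℝ Φ x a :=
    (hN.continuous.smul ((hΦ.continuous_fderiv one_ne_zero).clm_apply continuous_const))
      |>.integrable_of_hasCompactSupport (hc.fderiv_apply (𝕜 := ℝ) a).smul_left
  have i2 : Integrable fun x => (fderiv ℝ (newtonReg ε) (y - x) a) • Φ x :=
    ((((contDiff_newtonReg ε).continuous_fderiv one_ne_zero).clm_apply continuous_const).comp
      (continuous_const.sub continuous_id) |>.smul hΦ.continuous).integrable_of_hasCompactSupport
      hc.smul_left
  rw [integral_sub i1 i2] at h0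
  exact sub_eq_zero.1 h0

/-- **The regularised potentials converge** (vector-valued form of the tree's
`tendsto_integral_newtonReg_mul`): `∫ Φ_ε(y − x) • g(x) dx → ∫ Γ(y − x) • g(x) dx` as `ε → 0⁺`,
for `g ∈ C_c`, with the explicit rate `2‖g‖_∞ ε²`. [folklore] -/
theorem tendsto_integral_newtonReg_smul [CompleteSpace F] {g : (EuclideanSpace ℝ (Fin 3)) → F} (hg : Continuous g)
    (hgc : HasCompactSupport g) (y : (EuclideanSpace ℝ (Fin 3))) :
    Tendsto (fun ε => ∫ x, newtonReg ε (y - x) • g x) (𝓝[>] 0)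
      (𝓝 (∫ x, newtonKernel (y - x) • g x)) := by
  obtain ⟨G, hG⟩ := hg.bounded_above_of_compact_support hgc
  have hG0 : 0 ≤ G := (norm_nonneg _).trans (hG 0)
  have hi2 := integrable_newtonKernel_smul hg hgc y
  have key : ∀ ε, 0 < ε →
      ‖(∫ x, newtonReg ε (y - x) • g x) - ∫ x, newtonKernel (y - x) • g x‖ ≤ 2 * G * ε ^ 2 := by
    intro ε hε
    have hi1 : Integrable fun x => newtonReg ε (y - x) • g x :=
      (((contDiff_newtonReg ε (n := 0)).continuous.comp (continuous_const.sub continuous_id)).smul hg)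
        |>.integrable_of_hasCompactSupport hgc.smul_left
    rw [← integral_sub hi1 hi2]
    have hmaj : Integrable fun x : (EuclideanSpace ℝ (Fin 3)) => (2 * Real.pi)⁻¹ * ε * G * nearProfile₂ ε ‖y - x‖ :=
      ((integrable_nearProfile₂_norm hε).comp_sub_left y).const_mul _
    calc ‖∫ x, (newtonReg ε (y - x) • g x - newtonKernel (y - x) • g x)‖
        ≤ ∫ x, (2 * Real.pi)⁻¹ * ε * G * nearProfile₂ ε ‖y - x‖ := by
          refine norm_integral_le_of_norm_le hmaj (Eventually.of_forall fun x => ?_)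
          rw [← sub_smul, norm_smul, Real.norm_eq_abs]
          calc |newtonReg ε (y - x) - newtonKernel (y - x)| * ‖g x‖
              ≤ ((2 * Real.pi)⁻¹ * ε * nearProfile₂ ε ‖y - x‖) * G :=
                mul_le_mul (abs_newtonReg_sub_newtonKernel_le hε _) (hG x) (norm_nonneg _)
                  (mul_nonneg (by positivity) (nearProfile₂_nonneg _ _))
            _ = (2 * Real.pi)⁻¹ * ε * G * nearProfile₂ ε ‖y - x‖ := by ring
      _ = (2 * Real.pi)⁻¹ * ε * G * (4 * Real.pi * ε) := by
          rw [integral_const_mul, integral_sub_left_eq_self (fun z : (EuclideanSpace ℝ (Fin 3)) => nearProfile₂ ε ‖z‖) volume y,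
            integral_nearProfile₂_norm_eq hε]
      _ = 2 * G * ε ^ 2 := by field_simp; ring
  have hdiff : Tendsto (fun ε => (∫ x, newtonReg ε (y - x) • g x) - ∫ x, newtonKernel (y - x) • g x)
      (𝓝[>] 0) (𝓝 0) := by
    refine squeeze_zero_norm' ?_ ?_ (a := fun ε => 2 * G * ε ^ 2)
    · filter_upwards [self_mem_nhdsWithin] with ε hε
      exact key ε hε
    · have : Tendsto (fun ε : ℝ => 2 * G * ε ^ 2) (𝓝 0) (𝓝 (2 * G * 0 ^ 2)) :=
        (continuous_const.mul (continuous_pow 2)).tendsto 0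
      rw [zero_pow two_ne_zero, mul_zero] at this
      exact this.mono_left nhdsWithin_le_nhds
  have := hdiff.add_const (∫ x, newtonKernel (y - x) • g x)
  simpa using this

/-- **The regularised gradient potentials converge**:
`∫ DΦ_ε(y − x)(a) • g(x) dx → ∫ DΓ(y − x)(a) • g(x) dx` as `ε → 0⁺`, for `g ∈ C_c`
(the kernels differ by `O(1_{‖w‖<2ε}‖w‖⁻²)`, whose integral is `O(ε)`). [folklore] -/
theorem tendsto_integral_fderiv_newtonReg_smul [CompleteSpace F] {g : (EuclideanSpace ℝ (Fin 3)) → F} (hg : Continuous g)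
    (hgc : HasCompactSupport g) (y a : (EuclideanSpace ℝ (Fin 3))) :
    Tendsto (fun ε => ∫ x, (fderiv ℝ (newtonReg ε) (y - x) a) • g x) (𝓝[>] 0)
      (𝓝 (∫ x, (fderiv ℝ newtonKernel (y - x) a) • g x)) := by
  obtain ⟨G, hG⟩ := hg.bounded_above_of_compact_support hgc
  have hG0 : 0 ≤ G := (norm_nonneg _).trans (hG 0)
  obtain ⟨CW, hCW0, hCW⟩ := exists_norm_fderiv_newtonReg_sub_fderiv_newtonKernel_le
  have hi2 := integrable_fderiv_newtonKernel_smul hg hgc y a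
  have key : ∀ ε, 0 < ε → ‖(∫ x, (fderiv ℝ (newtonReg ε) (y - x) a) • g x) -
      ∫ x, (fderiv ℝ newtonKernel (y - x) a) • g x‖ ≤ CW * ‖a‖ * G * (4 * Real.pi * (2 * ε)) := by
    intro ε hε
    have hi1 : Integrable fun x => (fderiv ℝ (newtonReg ε) (y - x) a) • g x :=
      ((((contDiff_newtonReg ε).continuous_fderiv one_ne_zero).clm_apply continuous_const).comp
        (continuous_const.sub continuous_id) |>.smul hg).integrable_of_hasCompactSupport hgc.smul_left
    rw [← integral_sub hi1 hi2]
    have h2ε : 0 < 2 * ε := by positivity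
    have hmaj : Integrable fun x : (EuclideanSpace ℝ (Fin 3)) => CW * ‖a‖ * G * nearProfile₂ (2 * ε) ‖y - x‖ :=
      ((integrable_nearProfile₂_norm h2ε).comp_sub_left y).const_mul _
    calc ‖∫ x, ((fderiv ℝ (newtonReg ε) (y - x) a) • g x - (fderiv ℝ newtonKernel (y - x) a) • g x)‖
        ≤ ∫ x, CW * ‖a‖ * G * nearProfile₂ (2 * ε) ‖y - x‖ := by
          refine norm_integral_le_of_norm_le hmaj (Eventually.of_forall fun x => ?_)
          rw [← sub_smul, norm_smul, show fderiv ℝ (newtonReg ε) (y - x) a -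
            fderiv ℝ newtonKernel (y - x) a =
            (fderiv ℝ (newtonReg ε) (y - x) - fderiv ℝ newtonKernel (y - x)) a from rfl]
          calc ‖(fderiv ℝ (newtonReg ε) (y - x) - fderiv ℝ newtonKernel (y - x)) a‖ * ‖g x‖
              ≤ (CW * nearProfile₂ (2 * ε) ‖y - x‖ * ‖a‖) * G :=
                mul_le_mul ((ContinuousLinearMap.le_opNorm _ _).trans
                  (mul_le_mul_of_nonneg_right (hCW ε hε _) (norm_nonneg _))) (hG x)
                  (norm_nonneg _)
                  (mul_nonneg (mul_nonneg hCW0 (nearProfile₂_nonneg _ _)) (norm_nonneg _))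
            _ = CW * ‖a‖ * G * nearProfile₂ (2 * ε) ‖y - x‖ := by ring
      _ = CW * ‖a‖ * G * (4 * Real.pi * (2 * ε)) := by
          rw [integral_const_mul, integral_sub_left_eq_self
            (fun z : (EuclideanSpace ℝ (Fin 3)) => nearProfile₂ (2 * ε) ‖z‖) volume y, integral_nearProfile₂_norm_eq h2ε]
  have hdiff : Tendsto (fun ε => (∫ x, (fderiv ℝ (newtonReg ε) (y - x) a) • g x) -
      ∫ x, (fderiv ℝ newtonKernel (y - x) a) • g x) (𝓝[>] 0) (𝓝 0) := by
    refine squeeze_zero_norm' ?_ ?_ (a := fun ε => CW * ‖a‖ * G * (4 * Real.pi * (2 * ε)))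
    · filter_upwards [self_mem_nhdsWithin] with ε hε
      exact key ε hε
    · have : Tendsto (fun ε : ℝ => CW * ‖a‖ * G * (4 * Real.pi * (2 * ε))) (𝓝 0)
          (𝓝 (CW * ‖a‖ * G * (4 * Real.pi * (2 * 0)))) :=
        ((continuous_const.mul (continuous_const.mul (continuous_const.mul continuous_id))).tendsto 0)
      rw [mul_zero, mul_zero, mul_zero] at this
      exact this.mono_left nhdsWithin_le_nhds
  have := hdiff.add_const (∫ x, (fderiv ℝ newtonKernel (y - x) a) • g x)
  simpa using this

/-- **The distributional gradient of the Newtonian kernel is its pointwise gradient**: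
for `Φ ∈ C¹_c(ℝ³; F)`, `y, a ∈ ℝ³`,
`∫ Γ(y − x) • ∂ₐΦ(x) dx = ∫ ∂ₐΓ(y − x) • Φ(x) dx` — the integration by parts against the
`W^{1,1}_loc` kernel `Γ`, obtained from the regularised identity
(`integral_newtonReg_smul_fderiv_eq`) in the limit `ε → 0⁺` (both sides converge: the kernels
differ on `‖w‖ < 2ε` by locally integrable amounts with integral `O(ε²)`, `O(ε)`). This is
the form in which `Δ(Γ * φ) = φ`-type identities are used at first order (Gilbarg–Trudinger,
Lemma 4.1: `D(Γ * f) = (DΓ) * f`). [cite: GilbargTrudinger2001, Lemma 4.1] -/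
theorem integral_newtonKernel_smul_fderiv_eq [CompleteSpace F] {Φ : (EuclideanSpace ℝ (Fin 3)) → F} (hΦ : ContDiff ℝ 1 Φ)
    (hc : HasCompactSupport Φ) (y a : (EuclideanSpace ℝ (Fin 3))) :
    ∫ x, newtonKernel (y - x) • fderiv ℝ Φ x a = ∫ x, (fderiv ℝ newtonKernel (y - x) a) • Φ x := by
  have h1 := tendsto_integral_newtonReg_smul
    ((hΦ.continuous_fderiv one_ne_zero).clm_apply continuous_const) (hc.fderiv_apply (𝕜 := ℝ) a) y
  have h2 := tendsto_integral_fderiv_newtonReg_smul hΦ.continuous hc y a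
  have he : (fun ε => ∫ x, newtonReg ε (y - x) • fderiv ℝ Φ x a) =
      fun ε => ∫ x, (fderiv ℝ (newtonReg ε) (y - x) a) • Φ x :=
    funext fun ε => integral_newtonReg_smul_fderiv_eq hΦ hc ε y a
  rw [he] at h1
  exact tendsto_nhds_unique h1 h2

end WeakGradient

/-! ### The Biot–Savart integral of a test field is `−Γ * curl` -/

section TestField

-- nested operator types `ℝ³ →L[ℝ] ℝ³ →L[ℝ] ℝ³`
set_option maxSynthPendingDepth 3

/-- `curlCLM (⟪g, ·⟫ ⊗ v) = g × v`: the curl matrix of the rank-one Jacobian `e ↦ ⟪g, e⟫ v` is the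
cross product (this is `curl (φ v) = ∇φ × v` for constant `v`). [folklore] -/
theorem curlCLM_smulRight_innerSL (g v : (EuclideanSpace ℝ (Fin 3))) :
    curlCLM ((innerSL ℝ g).smulRight v) = cross g v := by
  rw [curlCLM_apply]
  simp only [ContinuousLinearMap.smulRight_apply, innerSL_apply_apply, PiLp.smul_apply, smul_eq_mul,
    EuclideanSpace.inner_single_right, one_mul, cross, cross_apply, conj_trivial]

/-- `v × w = −(w × v)`. [folklore] -/
theorem cross_swap (v w : (EuclideanSpace ℝ (Fin 3))) : cross v w = -cross w v := by
  simp only [cross]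
  rw [← cross_anticomm, WithLp.toLp_neg]

/-- **The Biot–Savart kernel through the gradient of the Newtonian kernel**: for `z ≠ 0`,
`K(z) h = h × ∇Γ(z) = −curlCLM (DΓ(z) ⊗ h)` (`∇Γ(z) = z/(4π‖z‖³)`; Majda–Bertozzi (2.92)–(2.94):
`K₃ * ω = −curl ψ`, `ψ` the Newtonian potential of `ω`). [folklore] -/
theorem biotSavartKernel_eq_neg_curlCLM_smulRight {z : (EuclideanSpace ℝ (Fin 3))} (hz : z ≠ 0) (h : (EuclideanSpace ℝ (Fin 3))) :
    biotSavartKernel z h = -curlCLM ((fderiv ℝ newtonKernel z).smulRight h) := by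
  have e : ((4 * Real.pi * ‖z‖ ^ 3)⁻¹ • innerSL ℝ z : (EuclideanSpace ℝ (Fin 3)) →L[ℝ] ℝ).smulRight h =
      (4 * Real.pi * ‖z‖ ^ 3)⁻¹ • ((innerSL ℝ z : (EuclideanSpace ℝ (Fin 3)) →L[ℝ] ℝ).smulRight h) := by
    ext e
    simp [mul_smul]
  rw [fderiv_newtonKernel hz, e, map_smul, curlCLM_smulRight_innerSL, cross_swap z h, smul_neg,
    neg_neg, biotSavartKernel]

variable {Φ : (EuclideanSpace ℝ (Fin 3)) → (EuclideanSpace ℝ (Fin 3))}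

/-- Integrability of the rank-one field `x ↦ DΓ(y − x) ⊗ Φ(x)` for `Φ ∈ C_c`. [folklore] -/
theorem integrable_fderiv_newtonKernel_smulRight (hΦ : Continuous Φ) (hc : HasCompactSupport Φ)
    (y : (EuclideanSpace ℝ (Fin 3))) : Integrable fun x => (fderiv ℝ newtonKernel (y - x)).smulRight (Φ x) := by
  obtain ⟨R, hR⟩ : ∃ R : ℝ, tsupport Φ ⊆ closedBall (0 : (EuclideanSpace ℝ (Fin 3))) R :=
    (hc.isCompact.isBounded).subset_closedBall 0
  obtain ⟨G, hG⟩ := hΦ.bounded_above_of_compact_support hc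
  have hG0 : 0 ≤ G := (norm_nonneg _).trans (hG 0)
  set ρ : ℝ := ‖y‖ + |R| + 1 with hρ
  have hρ0 : 0 < ρ := by positivity
  have hmaj : Integrable fun x : (EuclideanSpace ℝ (Fin 3)) => (4 * Real.pi)⁻¹ * G * nearProfile₂ ρ ‖y - x‖ :=
    ((integrable_nearProfile₂_norm hρ0).comp_sub_left y).const_mul _
  refine hmaj.mono' ?_ (Eventually.of_forall fun x => ?_)
  · have h1 : Measurable fun x : (EuclideanSpace ℝ (Fin 3)) => fderiv ℝ newtonKernel (y - x) :=
      (measurable_fderiv ℝ newtonKernel).comp (measurable_const.sub measurable_id)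
    have h2 : Continuous fun p : ((EuclideanSpace ℝ (Fin 3)) →L[ℝ] ℝ) × (EuclideanSpace ℝ (Fin 3)) => p.1.smulRight p.2 :=
      (ContinuousLinearMap.smulRightL ℝ (EuclideanSpace ℝ (Fin 3)) (EuclideanSpace ℝ (Fin 3))).continuous₂
    have h3 := h2.measurable.comp (h1.prodMk hΦ.measurable)
    exact h3.aestronglyMeasurable
  · by_cases hx : x ∈ tsupport Φ
    · have hxn : ‖x‖ ≤ R := mem_closedBall_zero_iff.1 (hR hx)
      have hyx : ‖y - x‖ < ρ := by
        calc ‖y - x‖ ≤ ‖y‖ + ‖x‖ := norm_sub_le _ _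
          _ ≤ ‖y‖ + |R| := by linarith [le_abs_self R]
          _ < ρ := by rw [hρ]; linarith
      rw [ContinuousLinearMap.norm_smulRight_apply]
      calc ‖fderiv ℝ newtonKernel (y - x)‖ * ‖Φ x‖ ≤ (4 * Real.pi * ‖y - x‖ ^ 2)⁻¹ * G :=
            mul_le_mul (norm_fderiv_newtonKernel_le _) (hG x) (norm_nonneg _) (by positivity)
        _ = (4 * Real.pi)⁻¹ * G * nearProfile₂ ρ ‖y - x‖ := by
            unfold nearProfile₂
            rw [if_pos hyx, mul_inv]
            ring
    · have h0 : (fderiv ℝ newtonKernel (y - x)).smulRight (Φ x) = 0 := by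
        rw [image_eq_zero_of_notMem_tsupport hx]
        ext e
        simp
      rw [h0, norm_zero]
      exact mul_nonneg (by positivity) (nearProfile₂_nonneg _ _)

/-- Integrability of `x ↦ Γ(y − x) • DΦ(x)` (operator-valued) for `Φ ∈ C¹_c`. [folklore] -/
theorem integrable_newtonKernel_smul_fderiv (hΦ : ContDiff ℝ 1 Φ) (hc : HasCompactSupport Φ)
    (y : (EuclideanSpace ℝ (Fin 3))) : Integrable fun x => newtonKernel (y - x) • fderiv ℝ Φ x :=
  integrable_newtonKernel_smul (hΦ.continuous_fderiv one_ne_zero) (hc.fderiv (𝕜 := ℝ)) y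

/-- **The Biot–Savart integral of a `C¹_c` field is minus the Newtonian potential of its curl**:
`(K₃ * Φ)(y) = −∫ Γ(y − x) curl Φ(x) dx` (Majda–Bertozzi, Prop. 2.16, (2.92)–(2.94):
`v = −curl ψ`, `ψ` the Newtonian potential). Proof: off the null set `{y}` the integrand is
`−curlCLM (DΓ(y − x) ⊗ Φ(x))` (`biotSavartKernel_eq_neg_curlCLM_smulRight`); `curlCLM` commutes
with the Bochner integral; `∫ DΓ(y − x) ⊗ Φ(x) dx = ∫ Γ(y − x) • DΦ(x) dx` as operators, by the
distributional-gradient identity `integral_newtonKernel_smul_fderiv_eq` applied to each vector;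
and `curlCLM (Γ • DΦ) = Γ • curl Φ`. [cite: MajdaBertozziCUP2002, §2.4.1 Prop. 2.16 with (2.92)–(2.94) (p. 63–64 of the held text)] -/
theorem biotSavart_eq_neg_integral_newtonKernel_smul_curl (hΦ : ContDiff ℝ 1 Φ)
    (hc : HasCompactSupport Φ) (y : (EuclideanSpace ℝ (Fin 3))) :
    biotSavart Φ y = -∫ x, newtonKernel (y - x) • curl Φ x := by
  have hT := integrable_fderiv_newtonKernel_smulRight hΦ.continuous hc y
  have hS := integrable_newtonKernel_smul_fderiv hΦ hc y
  -- (1) the kernel integrand is `-curlCLM (DΓ(y - x) ⊗ Φ x)` for `x ≠ y`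
  have h1 : biotSavart Φ y = -curlCLM (∫ x, (fderiv ℝ newtonKernel (y - x)).smulRight (Φ x)) := by
    rw [biotSavart]
    have hae : (fun x => biotSavartKernel (y - x) (Φ x)) =ᵐ[volume]
        fun x => -curlCLM ((fderiv ℝ newtonKernel (y - x)).smulRight (Φ x)) := by
      have hy : ∀ᵐ x ∂(volume : Measure (EuclideanSpace ℝ (Fin 3))), x ∉ ({y} : Set (EuclideanSpace ℝ (Fin 3))) :=
        measure_eq_zero_iff_ae_notMem.1 (measure_singleton y)
      filter_upwards [hy] with x hx
      exact biotSavartKernel_eq_neg_curlCLM_smulRight (sub_ne_zero.2 (Ne.symm hx)) (Φ x)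
    rw [integral_congr_ae hae, integral_neg, ContinuousLinearMap.integral_comp_comm curlCLM hT]
  -- (2) `∫ DΓ(y - x) ⊗ Φ x = ∫ Γ(y - x) • DΦ x` by the distributional-gradient identity
  have h2 : ∫ x, (fderiv ℝ newtonKernel (y - x)).smulRight (Φ x) =
      ∫ x, newtonKernel (y - x) • fderiv ℝ Φ x := by
    refine ContinuousLinearMap.ext fun a => ?_
    rw [ContinuousLinearMap.integral_apply hT, ContinuousLinearMap.integral_apply hS]
    simp only [ContinuousLinearMap.smulRight_apply, _root_.FunLike.coe_smul, Pi.smul_apply]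
    exact (integral_newtonKernel_smul_fderiv_eq hΦ hc y a).symm
  -- (3) `curlCLM` of the right side
  rw [h1, h2, ← ContinuousLinearMap.integral_comp_comm curlCLM hS]
  congr 1
  refine integral_congr_ae (Eventually.of_forall fun x => ?_)
  simp only [map_smul, curl_eq_curlCLM]

/-- **The Biot–Savart integral annihilates gradients**: `K₃ * ∇θ = 0` for `θ ∈ C²_c`
(`curl ∇θ = 0`, the tree's `curl_gradient_eq_zero_holds`, in the previous formula). This is the
weak divergence-freeness of `K₃ * ω` read through the symmetry of `K₃`
(Majda–Bertozzi, Prop. 2.16: `div v = 0`). [cite: MajdaBertozziCUP2002, §2.4.1 Prop. 2.16 (p. 63 of the held text)] -/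
theorem biotSavart_gradient_eq_zero {θ : (EuclideanSpace ℝ (Fin 3)) → ℝ} (hθ : ContDiff ℝ 2 θ)
    (hc : HasCompactSupport θ) : biotSavart (gradient θ) = 0 := by
  have hg1 : ContDiff ℝ 1 (gradient θ) :=
    (InnerProductSpace.toDual ℝ (EuclideanSpace ℝ (Fin 3))).symm.contDiff.comp (hθ.fderiv_right (m := 1) le_rfl)
  have hgc : HasCompactSupport (gradient θ) :=
    (hc.fderiv (𝕜 := ℝ)).comp_left (g := (InnerProductSpace.toDual ℝ (EuclideanSpace ℝ (Fin 3))).symm) (map_zero _)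
  funext y
  rw [biotSavart_eq_neg_integral_newtonKernel_smul_curl hg1 hgc]
  have h0 : ∀ x, curl (gradient θ) x = 0 := fun x => curl_gradient_eq_zero_holds θ hθ x
  simp [h0]

end TestField

/-! ### Green's representation `∫ Γ(y − x) Δψ(x) dx = ψ(y)` -/

section Green

/-- **Green's representation formula on the whole space**: for `ψ ∈ C²_c(ℝ³)`,
`∫ Γ(y − x) Δψ(x) dx = ψ(y)` (Gilbarg–Trudinger (2.17), `Γ(x) = −(4π|x|)⁻¹` the fundamental
solution, `ΔΓ = δ`). From the tree's localised identity `∫ Γ₀ Δφ = φ(0) − ∫ λ φ`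
(`NewtonPotential.integral_newtonNear_mul_laplacian`) with radii so large that `Γ₀ = Γ` on the
support of `φ = ψ(y − ·)` and `λ φ = 0`. [cite: GilbargTrudinger2001, (2.17)] -/
theorem integral_newtonKernel_mul_laplacian {ψ : (EuclideanSpace ℝ (Fin 3)) → ℝ} (hψ : ContDiff ℝ 2 ψ)
    (hc : HasCompactSupport ψ) (y : (EuclideanSpace ℝ (Fin 3))) :
    ∫ x, newtonKernel (y - x) * (Δ ψ) x = ψ y := by
  obtain ⟨R, hR⟩ : ∃ R : ℝ, tsupport ψ ⊆ closedBall (0 : (EuclideanSpace ℝ (Fin 3))) R :=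
    (hc.isCompact.isBounded).subset_closedBall 0
  set r₀ : ℝ := ‖y‖ + |R| + 1 with hr₀
  have h₀ : 0 < r₀ := by positivity
  have h₁ : r₀ < r₀ + 1 := by linarith
  -- radii: if `ψ(y - z) ≠ 0` (or any derivative) then `‖z‖ < r₀`
  have hsupp : ∀ z : (EuclideanSpace ℝ (Fin 3)), y - z ∈ tsupport ψ → ‖z‖ < r₀ := fun z hz => by
    have h1 : ‖y - z‖ ≤ R := mem_closedBall_zero_iff.1 (hR hz)
    calc ‖z‖ = ‖y - (y - z)‖ := by rw [sub_sub_cancel]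
      _ ≤ ‖y‖ + ‖y - z‖ := norm_sub_le _ _
      _ ≤ ‖y‖ + |R| := by linarith [le_abs_self R]
      _ < r₀ := by rw [hr₀]; linarith
  have hφ : ContDiff ℝ 2 fun z : (EuclideanSpace ℝ (Fin 3)) => ψ (y - z) := hψ.comp (contDiff_const.sub contDiff_id)
  have key := integral_newtonNear_mul_laplacian h₀ h₁ hφ
  rw [sub_zero] at key
  -- the correction term vanishes
  have hlam : ∀ z : (EuclideanSpace ℝ (Fin 3)), newtonFarLaplacian r₀ (r₀ + 1) z * ψ (y - z) = 0 := fun z => by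
    by_cases hz : y - z ∈ tsupport ψ
    · rw [newtonFarLaplacian_eq_zero_of_lt h₀.le h₁ (hsupp z hz), zero_mul]
    · rw [image_eq_zero_of_notMem_tsupport hz, mul_zero]
  simp_rw [hlam, integral_zero, sub_zero] at key
  -- `Γ₀ Δφ = Γ (Δψ)(y - ·)` everywhere
  have hnear : ∀ z : (EuclideanSpace ℝ (Fin 3)), newtonNear r₀ (r₀ + 1) z * (Δ fun w => ψ (y - w)) z =
      newtonKernel z * (Δ ψ) (y - z) := fun z => by
    rw [laplacian_comp_const_sub]
    by_cases hz : y - z ∈ tsupport ψ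
    · rw [newtonNear_eq_newtonKernel h₀.le h₁ (hsupp z hz).le]
    · rw [FluidPDE.laplacian_eq_zero_of_notMem_tsupport hz, mul_zero, mul_zero]
  simp_rw [hnear] at key
  rw [← key]
  have h := integral_sub_left_eq_self (fun x => newtonKernel (y - x) * (Δ ψ) x) volume y
  simp only [sub_sub_cancel] at h
  exact h.symm

end Green

end Literature.Analysis.FluidPDE
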